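import Summits.BirchSwinnertonDyer.Rank1Residual.X11b.Three.StepLAtThree
import Summits.BirchSwinnertonDyer.Rank1Residual.X11b.HalvesReceptacle
import HarnessLib

/-!
# X11b @ `p = 3`, S10 HALVES@3: `exists_isNewformOf ∧ CTL₀@3 ∧ H1 ∧ H2 ∧ H3 ⟹ Three.StepLAt W` — S0's
# typed conjecture at `3 ‖ N` REFINED (never replaced) into the printed halves, over the BDP
# interface `IsBDPLFunction`

HONEST FRAMING (cell `b2b-bsdres`, run/shared/lean/b2b/bsd-rank1-residual/, verbatim in every
file): the goal of the cell is to DELETE the COMBINATION-SHAPED residual classes of the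
Birch–Swinnerton-Dyer formula for ALL analytic-rank `≤ 1` elliptic curves over `ℚ` — "full BSD
formula for every rank `≤ 1` curve in class `C`" assembled STRICTLY from published theorems — so
that the rank-`≤ 1` remainder becomes exactly the CONSTRUCTION-SHAPED classes, which are TYPED
(missing-input `Prop`s), NOT attempted. This is not "finishing BSD". Team `x11b3` = N8/O2 (X11b at
`p = 3`: `3 ‖ N`, `r_an = 1`, `E[3]` irreducible): RESEARCH ROUTES; published theorems only; the
construction-shaped remainder is TYPED, not attempted; census output = EVIDENCE, never a Literature
fact; nothing booked; no label change; O2 stays OPEN; no route opened.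

PROVENANCE (team `cells/x11b3/`, sub-target S10 · HALVES@3, LEAD DEALS #4 (row S10), #5 (R5-7, R5-12),
#6 (R6-3, R6-12); OWNERS A6.3 (2) namespace treaty — `₃`-specialised names in `…X11b.Three`, no
general-`p` shape declared): the statements and proofs of this file are route planner 2's
kernel-checked sketch `HOME/b2b-bsdres-x11b3-r2/HalvesSketchR2.lean` (sha16 296bb72c4ec76f27, §3),
reviewed and SIGNED by route planner 1 (signature of record `cells/x11b3/LINE-W.md` v1.9h, checklist
R-a…R-m of W0 ADDENDUM 2: one frame `(ι', Ω_K, Ω_p, L)` bound ONCE by H1 and consumed by H2/H3 (R-a,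
R-l); H2's value shape with a unit and the exact `ord₃(1 − a₃/3) = −1` (R-d); newform binder
`IsNewformOf W f` at level `N = conductor` (R-e); H3 = the LOWER-BOUND direction only,
`Ch_Λ(X_ac)·R₀⟦T⟧ ⊆ (L)` (R-f, R-k); periods typed `Ω_p ∈ R₀ˣ`, `Ω_K ≠ 0` (R-i); junk-`ord` guard by
the `HasValueAt`-with-unit currency (R-j); anti-vacuity (R-g)); ported VERBATIM (the four `Prop`s
byte-identical in statement), tagged `@[conjecture]` (open named inputs stated in our theories —
obligation nodes, NOT vendored facts), and filed by seat `b2b-bsdres-x11b3-p7` (gen. 2) as PROXY for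
the S10 owner `b2b-bsdres-x11b3-p9`. The general-`p` algebra (`toUnr`, `logOmega`,
`two_mul_sub_one_le_valuation`, `imcLowerWaldspurgerOnTreeAt_of_value_of_dvd`) is
`X11b/HalvesReceptacle.lean`.

## What is kernel-checked here (two THEOREMS of assembly + five hypothesis-shaped/plain `Prop`s; no
## fact, no placeholder)

S0's binder of record at `p = 3` is `IMCLowerWaldspurgerOnTreeAt 3 κ 𝔭 γ ι P`, universally closed
into `Three.StepLAt W` (`Three/StepLAtThree.lean`). HALVES@3 REFINES (never replaces) that binder
into the printed halves — each a TYPED input over S0's own datum (same binders, verbatim):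
* **CTL₀@3** (`CharTorsionAt₃`): `X_ac` is `Λ`-torsion with principal characteristic ideal whose
  generator has non-zero constant term (`∃ n, HasCharValuationAt … n`) — on the tight locus A1 this
  is the THEOREM `Three.p2ControlOnTreeAt_of_locus` (`ControlIdentityLocus.lean`) +
  `Halves.exists_hasCharValuationAt_of_controlOnTreeAt`; elsewhere the Cas18 Thm. 2.3 shape; it is
  NOT derivable from H2 ∧ H3 (the cofactor `G(0)` may vanish) — R-g: an EXPLICIT fourth hypothesis
  (r1 v1.9e endorsement);
* **H1 = BDP-EXISTS@3** (`BDPExistsAt₃`): for the S0 datum and the newform `f` of `E`, an embedding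
  datum `ι' : ℚ̄_3 ≃ ℂ` inducing `𝔭` (`InducesPrime`, = Castella 2018 Thm. 3.1's compatibility clause,
  = `X11b/EmbeddingDatumPrime.lean`'s `forall_mem_primeOfEmbeddingDatum_iff`; anti-vacuity of its
  `∃ ι'` for imaginary quadratic `K` and every `𝔭 ∋ 3` is multr1-p1's
  `X11b.exists_datum_forall_mem_iff` (p254679) — the one-line corollary `∃ ι', InducesPrime ι' 𝔭`
  rides as an append once that module's olean is on the farm), periods
  `Ω_K ≠ 0`, `Ω_p ∈ R₀ˣ` and `L ∈ R₀⟦T⟧` with `IsBDPLFunction ι' 𝔭 κ γ f Ω_K Ω_p L` (Literature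
  interface, `BDPAnticyclotomicPAdicLFunction.lean`);
* **H2 = BDP-VALUE@3** (`BDPValueAt₃`): every such `L` has value at the trivial character
  `L(0) = u · ((1 − a₃(E)·3⁻¹) · log_{ω_E} P)²` with `u ∈ R₀ˣ` (Cas18 Thm. 3.2 shape; `a₃ = a₃(E) =
  W.LFunction 3 ∈ {±1}` at multiplicative `3`, so `ord₃(1 − a₃/3) = −1` EXACTLY — R-d,
  `Halves.norm_one_sub_div_eq`);
* **H3 = MI-W3** (`IMCDivAt₃`): every such `L` divides the base change of `Ch_Λ(X_ac)`:
  `Ch_Λ(X_ac)·R₀⟦T⟧ ⊆ (L)` (the Wan-side divisibility, Cas18 Thm. 3.3 shape; LOWER bound only).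
Proved: `stepLAt_of_halves₃ : exists_isNewformOf → CharTorsionAt₃ W → BDPExistsAt₃ W →
BDPValueAt₃ W → IMCDivAt₃ W → Three.StepLAt W` (H1 CONSUMED: it produces the frame at which H2 and
H3 are instantiated; `log_{ω_E} P ≠ 0` and `[T⁰]L ≠ 0` are consequences), `bsdp_of_halves₃` (through
any `StepLAt W → BSDp W 3`, e.g. S3's `Three.stepLAt_iff_bsdp_of_locus` on A1, where CTL₀ is a
theorem), `lFunction_eq_one_or_eq_neg_one_of_isNewformOf` (`a_p = ±1` at multiplicative `p`, every
`p`).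

## Status of the four inputs (R-h labels; NOTHING here is asserted)
H1 = W2: the CONSTRUCTION of `L_𝔭^{BDP}(f/K)` at `3 ‖ N` is MISSING IN PRINT as a Literature fact of
this tree ([CastellaHsieh2018] §3.3 / [Castella2018] §3.3 need `p ∤ N`, `p ≥ 5`; the fact
`castella2018_exists_isBDPLFunction` carries `5 ≤ p`; W2-an ✓ in refereed print by Liu–Zhang–Zhang,
Duke Math. J. 167 (2018) Thm. 3.8 / 3.10 = arXiv:1511.08172 — lit2 §12, r2/r1 W2 SPLIT v1.9f: W2-int
(the integral `IsBDPLFunction`-normalised member + constants dictionary) remains the residual).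
H2 = [Castella2018] Thm. 3.2 at `p ∣ N`: formal in the Waldspurger/BDP formula at `χ = 𝟙` GIVEN the
interpolating `L` — inherits W2. H3 = MI-W3, status string of record 'PRE-as-printed (p odd) ∧ W3-INH
∧ W3-MOD ∧ (β) ⊥-vacuous at 3' (OWNERS A5.3 ⟦2026-08-21T06:39Z⟧: EW16's tame interpolation datum has
no instance at `p = 3` — `𝒳^{pb} = ∅`, kernel record p252575
`X11Three.not_exists_dirichletCharacter_three_conductor_pair`; (β) ⊥-vacuous at 3 (EW16, p252575);
repair unprinted at weight `k`; CLW22 prints 3-admissible sections at weight 2 for `π_p` unramified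
only). CTL₀ = theorem on A1 only. Missing-in-print inputs stay construction-shaped and TYPED; the
BINDER OF RECORD stays S0's composite `Three.StepLAt` — HALVES refines, never replaces; O2 stays
OPEN; nothing is booked; no label changes.

References: [Castella2018] Thm. 2.3, Thm. 3.1, Thm. 3.2, Thm. 3.3, §5 (arXiv:1704.06608 pp. 5, 8–9,
12); [CastellaHsieh2018] §3.1–3.3; [BertoliniDarmonPrasanna2013] Thm. 5.13; [CastellaGrossiLeeSkinner2022] Thm. 5.1.3
(5.4); Liu–Zhang–Zhang, Duke Math. J. 167 (2018) Thm. 3.8 / 3.10 (arXiv:1511.08172); review checklist R-a…R-m (x11b3-r1,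
`cells/x11b3/LINE-W.md` W0 ADDENDUM 2, signature v1.9h); `CASTELLA-WAN.md` §14 (lit-cw).
-/

noncomputable section

open scoped Classical

open WeierstrassCurve NumberField IsDedekindDomain Field PowerSeries
  Literature.NumberTheory.EllipticCurves Literature.NumberTheory.EllipticCurves.ModularForms
  Literature.NumberTheory.EllipticCurves.Rank1Residual
  Literature.NumberTheory.GaloisRepresentations
  Summit.BirchSwinnertonDyer.Rank1Residual.X11b.AcSelmer
  Summit.BirchSwinnertonDyer.Rank1Residual.X11b.CongruenceLimit
  Summit.BirchSwinnertonDyer.Rank1Residual.X11b.Halves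

namespace Summit.BirchSwinnertonDyer.Rank1Residual.X11b.Three

universe u

/-! ## §3 The halves at `p = 3` over S0's datum, and `stepLAt_of_halves₃` -/

section HalvesAtThree

variable (W : WeierstrassCurve ℚ) [W.IsElliptic] [W.IsGloballyMinimal]

omit [W.IsElliptic] [W.IsGloballyMinimal] in
/-- `a_p(E) = ±1` at a prime `p` of multiplicative reduction, read off the newform of `E` (tree:
`IsNewformOf.cuspCoeff_eq_one_and_sq_of_split`, `IsNewformOf.cuspCoeff_eq_neg_one_and_dvd_of_nonsplit`).
At `p = 3` on class X11b this is the `a₃` of H2 (R-d). [cite: SilvermanAEC2009, App. C §16, a_p = ±1 at multiplicative p] -/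
theorem lFunction_eq_one_or_eq_neg_one_of_isNewformOf {N : ℕ} [NeZero N]
    {f : CuspForm (CongruenceSubgroup.Gamma0 N) 2}
    (hf : IsNewformOf W f) {p : ℕ} [Fact p.Prime] (hmult : Mult W p) :
    W.LFunction p = 1 ∨ W.LFunction p = -1 := by
  by_cases hsplit : W.HasSplitMultiplicativeReductionAtPrime p
  · left
    have h := (hf.cuspCoeff_eq_one_and_sq_of_split hsplit).1
    rw [hf.2 p] at h
    exact_mod_cast h
  · right
    have h := (hf.cuspCoeff_eq_neg_one_and_dvd_of_nonsplit hmult hsplit).1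
    rw [hf.2 p] at h
    exact_mod_cast h

/-- The embedding-compatibility clause of the BDP interface: `𝔭` is the prime of `K` above `p`
induced by `ι_p ∘ ι_∞⁻¹` (verbatim from `castella2018_exists_isBDPLFunction`). R-c: the prime
carried by `IsBDPLFunction` here is the SAME `𝔭` as S0's (the prime at which `log_{ω_E}` and `X_ac`
are taken); print conventions (Cas18: `𝔭` induced by `ι_p`; CGLS: strict at `v̄`) are a
faithfulness item for the Literature pass, not a soundness item of this file. A PREDICATE with
parameters (a plain definition — nothing is asserted; not a named fact); for imaginary quadratic `K`
it says `𝔭 = primeOfEmbeddingDatum 3 ι' w.embedding` (`X11b/EmbeddingDatumPrime.lean`,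
`eq_primeOfEmbeddingDatum_of_forall_mem_iff`). [cite: Castella2018, §3.3 (arXiv:1704.06608 p. 9)] -/
def InducesPrime {K : Type} [Field K] [NumberField K] (ι' : PadicAlgCl 3 ≃+* ℂ)
    (𝔭 : HeightOneSpectrum (𝓞 K)) : Prop :=
  ∀ (w : InfinitePlace K) (k : 𝓞 K), k ∈ 𝔭.asIdeal ↔ ‖ι'.symm (w.embedding (k : K))‖ < 1

/-- **CTL₀@3** (hypothesis-shaped; R-g): over S0's datum, `X_ac^∅(E/K_∞)` is `Λ`-torsion with
principal characteristic ideal whose generator has non-zero constant term. A THEOREM on the tight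
locus A1 (`Three.p2ControlOnTreeAt_of_locus` + `exists_hasCharValuationAt_of_controlOnTreeAt`);
the Cas18 Thm. 2.3 / JSW Thm. 3.3.1 shape elsewhere. Nothing asserted.
[cite: Castella2018, Thm. 2.3 (arXiv:1704.06608 p. 5) (shape only; nothing asserted)] -/
@[conjecture]
def CharTorsionAt₃ : Prop :=
  ∀ (N : ℕ) [NeZero N] (K : Type) [Field K] [NumberField K] (Dt : ModularParametrizationData W N)
    (H : HeegnerDatum N (NumberField.discr K)) (ι : K →+* ℂ) (P : (W.baseChange K).toAffine.Point),
    ClassX11b W 3 → Surj W 3 → W.conductorNorm ℤ = N → IsImaginaryQuadratic K →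
    Odd (NumberField.discr K) → SatisfiesHeegnerHypothesis N K →
    (W.quadraticTwist (NumberField.discr K : ℚ)).entireLFunction 1 ≠ 0 →
    WeierstrassCurve.Affine.Point.map ι.toRatAlgHom P = heegnerPointComplex Dt H →
    ¬ (3 : ℤ) ∣ Dt.c → ¬ IsOfFinAddOrder P →
    ∀ (κ : ZpExtension K 3), κ.IsAnticyclotomic →
      ∀ (γ : Field.absoluteGaloisGroup K) [Fact (κ.IsTopGenerator γ)]
        (𝔭 : HeightOneSpectrum (𝓞 K)), ((3 : ℕ) : 𝓞 K) ∈ 𝔭.asIdeal →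
        𝔭.asIdeal.ramificationIdx (𝓞 ℚ) = 1 → 𝔭.asIdeal.inertiaDeg (𝓞 ℚ) = 1 →
        ∃ n : ℕ, XAc.HasCharValuationAt (W.baseChange K) 3 κ 𝔭 ∅ γ n

/-- **H1 = BDP-EXISTS@3** (hypothesis-shaped; R-h label: W2 — the CONSTRUCTION of `L_𝔭^{BDP}(f/K)`
at `3 ‖ N` is MISSING IN PRINT: [CastellaHsieh2018] §3.3 / [Castella2018] §3.3 need `p ∤ N`, `p ≥ 5`;
the Literature fact `castella2018_exists_isBDPLFunction` carries `5 ≤ p`, `¬ p ∣ N`). Over S0's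
datum and the newform `f` of `E`: an embedding datum `ι'` inducing `𝔭`, periods `Ω_K ≠ 0`,
`Ω_p ∈ R₀ˣ` (R-i) and `L ∈ R₀⟦T⟧` with the interpolation property `IsBDPLFunction` (which reads
`ε = −1` off `3 ∣ N`, R-e, and evaluates characters at `c⁻¹`, R-f). TYPED, not attempted; nothing
asserted. [cite: Castella2018, §3.3 (arXiv:1704.06608 p. 9) (shape only; construction missing in print at p ∣ N)] -/
@[conjecture]
def BDPExistsAt₃ : Prop :=
  ∀ (N : ℕ) [NeZero N] (K : Type) [Field K] [NumberField K] (Dt : ModularParametrizationData W N)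
    (H : HeegnerDatum N (NumberField.discr K)) (ι : K →+* ℂ) (P : (W.baseChange K).toAffine.Point),
    ClassX11b W 3 → Surj W 3 → W.conductorNorm ℤ = N → IsImaginaryQuadratic K →
    Odd (NumberField.discr K) → SatisfiesHeegnerHypothesis N K →
    (W.quadraticTwist (NumberField.discr K : ℚ)).entireLFunction 1 ≠ 0 →
    WeierstrassCurve.Affine.Point.map ι.toRatAlgHom P = heegnerPointComplex Dt H →
    ¬ (3 : ℤ) ∣ Dt.c → ¬ IsOfFinAddOrder P →
    ∀ (κ : ZpExtension K 3), κ.IsAnticyclotomic →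
      ∀ (γ : Field.absoluteGaloisGroup K) [Fact (κ.IsTopGenerator γ)]
        (𝔭 : HeightOneSpectrum (𝓞 K)), ((3 : ℕ) : 𝓞 K) ∈ 𝔭.asIdeal →
        𝔭.asIdeal.ramificationIdx (𝓞 ℚ) = 1 → 𝔭.asIdeal.inertiaDeg (𝓞 ℚ) = 1 →
        ∀ (f : CuspForm (CongruenceSubgroup.Gamma0 N) 2), IsNewformOf W f →
          ∃ ι' : PadicAlgCl 3 ≃+* ℂ, InducesPrime ι' 𝔭 ∧
            ∃ (ΩK : ℂ) (Ωp : (unrIntegers 3)ˣ) (L : UnrSeries 3),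
              ΩK ≠ 0 ∧ IsBDPLFunction ι' 𝔭 κ γ f ΩK ((Ωp : unrIntegers 3) : ℂ_[3]) L

/-- **H2 = BDP-VALUE@3** (hypothesis-shaped; R-h label: [Castella2018] Thm. 3.2 at `p ∣ N` — the
printed proof is formal in the Waldspurger/BDP formula at `χ = 𝟙` GIVEN the interpolating `L`, so it
inherits W2). Over S0's datum: every `L` with the interpolation property for `(ι', 𝔭, κ, γ, f, Ω_K,
Ω_p)` has value at the trivial character `L(0) = u·((1 − a₃(E)·3⁻¹)·log_{ω_E} P)²`, `u ∈ R₀ˣ`, where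
`P` is the Heegner point of the datum, `log_{ω_E}` is taken at the embedding `embAt K 3 𝔭`, and
`a₃(E) = W.LFunction 3 ∈ {±1}` (`3` multiplicative), so `ord₃(1 − a₃ 3⁻¹) = −1` (R-d,
`norm_one_sub_div_eq`). R-a: the SAME `L` as in H3 (both universal over one frame). TYPED, not
attempted; nothing asserted. [cite: Castella2018, Thm. 3.2 (arXiv:1704.06608 pp. 8–9) (shape only; nothing asserted)] -/
@[conjecture]
def BDPValueAt₃ : Prop :=
  ∀ (N : ℕ) [NeZero N] (K : Type) [Field K] [NumberField K] (Dt : ModularParametrizationData W N)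
    (H : HeegnerDatum N (NumberField.discr K)) (ι : K →+* ℂ) (P : (W.baseChange K).toAffine.Point),
    ClassX11b W 3 → Surj W 3 → W.conductorNorm ℤ = N → IsImaginaryQuadratic K →
    Odd (NumberField.discr K) → SatisfiesHeegnerHypothesis N K →
    (W.quadraticTwist (NumberField.discr K : ℚ)).entireLFunction 1 ≠ 0 →
    WeierstrassCurve.Affine.Point.map ι.toRatAlgHom P = heegnerPointComplex Dt H →
    ¬ (3 : ℤ) ∣ Dt.c → ¬ IsOfFinAddOrder P →
    ∀ (κ : ZpExtension K 3), κ.IsAnticyclotomic →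
      ∀ (γ : Field.absoluteGaloisGroup K) [Fact (κ.IsTopGenerator γ)]
        (𝔭 : HeightOneSpectrum (𝓞 K)) (h𝔭 : ((3 : ℕ) : 𝓞 K) ∈ 𝔭.asIdeal)
        (he : 𝔭.asIdeal.ramificationIdx (𝓞 ℚ) = 1) (hf : 𝔭.asIdeal.inertiaDeg (𝓞 ℚ) = 1),
        ∀ (f : CuspForm (CongruenceSubgroup.Gamma0 N) 2), IsNewformOf W f →
          ∀ (ι' : PadicAlgCl 3 ≃+* ℂ), InducesPrime ι' 𝔭 →
            ∀ (ΩK : ℂ) (Ωp : (unrIntegers 3)ˣ) (L : UnrSeries 3), ΩK ≠ 0 →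
              IsBDPLFunction ι' 𝔭 κ γ f ΩK ((Ωp : unrIntegers 3) : ℂ_[3]) L →
                ∃ u : (unrIntegers 3)ˣ, L.HasValueAt 0 (((u : unrIntegers 3) : ℂ_[3]) *
                  (algebraMap ℚ_[3] ℂ_[3] (((1 : ℚ_[3]) - ((W.LFunction 3 : ℤ) : ℚ_[3]) * (3 : ℚ_[3])⁻¹) *
                    logOmega W 3 (embAt K 3 𝔭 h𝔭 he hf) P)) ^ 2)

/-- **H3 = MI-W3** (hypothesis-shaped; R-h label of record: 'PRE-as-printed (p odd) ∧ W3-INH ∧ W3-MOD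
∧ (β) ⊥-vacuous at 3' — [Castella2018] the §1 (1.b) divisibility, from [Wan2020] Thm. 1.1 / Fouquet–Wan Thm. 4.41 (arXiv:2107.13726) at `3 ‖ N` inherits W2,
the level/`U_p` modifications, and the EW16 tame-datum vacuity at `3` (p252575); nothing in print
proves it at `p = 3`). Over
S0's datum: every `L` with the interpolation property divides the base change of the characteristic
ideal: `Ch_Λ(X_ac^∅)·R₀⟦T⟧ ⊆ (L)` in `R₀⟦T⟧` (R-k; base change along `toUnr 3 : ℤ_3 → R₀`). TYPED,
not attempted; nothing asserted. [cite: Castella2018, §1 (1.b) (arXiv p. 3) and Thm. 4.4 (p. 11); proof of Thm. 4.2, display (wan-thm) (p. 10)] [cite: Castella2018Erratum, Thm. 1.1 (p. 1)] -/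
@[conjecture]
def IMCDivAt₃ : Prop :=
  ∀ (N : ℕ) [NeZero N] (K : Type) [Field K] [NumberField K] (Dt : ModularParametrizationData W N)
    (H : HeegnerDatum N (NumberField.discr K)) (ι : K →+* ℂ) (P : (W.baseChange K).toAffine.Point),
    ClassX11b W 3 → Surj W 3 → W.conductorNorm ℤ = N → IsImaginaryQuadratic K →
    Odd (NumberField.discr K) → SatisfiesHeegnerHypothesis N K →
    (W.quadraticTwist (NumberField.discr K : ℚ)).entireLFunction 1 ≠ 0 →
    WeierstrassCurve.Affine.Point.map ι.toRatAlgHom P = heegnerPointComplex Dt H →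
    ¬ (3 : ℤ) ∣ Dt.c → ¬ IsOfFinAddOrder P →
    ∀ (κ : ZpExtension K 3), κ.IsAnticyclotomic →
      ∀ (γ : Field.absoluteGaloisGroup K) [Fact (κ.IsTopGenerator γ)]
        (𝔭 : HeightOneSpectrum (𝓞 K)), ((3 : ℕ) : 𝓞 K) ∈ 𝔭.asIdeal →
        𝔭.asIdeal.ramificationIdx (𝓞 ℚ) = 1 → 𝔭.asIdeal.inertiaDeg (𝓞 ℚ) = 1 →
        ∀ (f : CuspForm (CongruenceSubgroup.Gamma0 N) 2), IsNewformOf W f →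
          ∀ (ι' : PadicAlgCl 3 ≃+* ℂ), InducesPrime ι' 𝔭 →
            ∀ (ΩK : ℂ) (Ωp : (unrIntegers 3)ˣ) (L : UnrSeries 3), ΩK ≠ 0 →
              IsBDPLFunction ι' 𝔭 κ γ f ΩK ((Ωp : unrIntegers 3) : ℂ_[3]) L →
                (XAc.charIdeal (W.baseChange K) 3 κ 𝔭 ∅ γ).map (PowerSeries.map (toUnr 3)) ≤
                  Ideal.span {L}

variable {W} in
/-- **S10 HALVES@3**: `exists_isNewformOf ∧ CTL₀@3 ∧ H1 ∧ H2 ∧ H3 ⟹ Three.StepLAt W`. H1 is CONSUMED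
(it produces the frame `(ι', Ω_K, Ω_p, L)` at which H2 and H3 are instantiated); `a₃` is the
model-intrinsic `W.LFunction 3`; `log_{ω_E} P ≠ 0` and `[T⁰]L ≠ 0` are consequences. With S3
(`Three.stepLAt_iff_bsdp_of_locus`) this is `H1 ∧ H2 ∧ H3 ⇒ BSD₃` on the tight locus A1, where CTL₀
is a theorem. Nothing is asserted: all five antecedents are hypotheses; O2 stays OPEN.
[cite: Castella2018, §5 (arXiv:1704.06608 p. 12) (assembly shape at p ∣ N; inputs typed, not asserted)] -/
theorem stepLAt_of_halves₃ (hnf : exists_isNewformOf) (hctl : CharTorsionAt₃ W)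
    (h1 : BDPExistsAt₃ W) (h2 : BDPValueAt₃ W) (h3 : IMCDivAt₃ W) : StepLAt W := by
  intro N _ K _ _ Dt H ι P hX hsurj hN hK hodd hheeg hL1 hP hc hP0 κ hκ γ _ 𝔭 h𝔭 he hf
  subst hN
  obtain ⟨f, hfW⟩ := hnf W
  obtain ⟨ι', hι', ΩK, Ωp, L, hΩK, hL⟩ :=
    h1 _ K Dt H ι P hX hsurj rfl hK hodd hheeg hL1 hP hc hP0 κ hκ γ 𝔭 h𝔭 he hf f hfW
  obtain ⟨u, hu⟩ :=
    h2 _ K Dt H ι P hX hsurj rfl hK hodd hheeg hL1 hP hc hP0 κ hκ γ 𝔭 h𝔭 he hf f hfW ι' hι' ΩK Ωp L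
      hΩK hL
  have hdiv :=
    h3 _ K Dt H ι P hX hsurj rfl hK hodd hheeg hL1 hP hc hP0 κ hκ γ 𝔭 h𝔭 he hf f hfW ι' hι' ΩK Ωp L
      hΩK hL
  obtain ⟨n, hn⟩ := hctl _ K Dt H ι P hX hsurj rfl hK hodd hheeg hL1 hP hc hP0 κ hκ γ 𝔭 h𝔭 he hf
  exact imcLowerWaldspurgerOnTreeAt_of_value_of_dvd hn hdiv u (W.LFunction 3) hu

variable {W} in
/-- Corollary through S0: the halves give `BSDp W 3` wherever `Three.StepLAt W → BSDp W 3` is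
available (`Three.bsdp_of_stepLAt` with its fact binders, or S3 on the tight locus). Stated as the
bare implication to stay binder-free here. [folklore] -/
theorem bsdp_of_halves₃ (hstep : StepLAt W → BSDp W 3) (hnf : exists_isNewformOf)
    (hctl : CharTorsionAt₃ W) (h1 : BDPExistsAt₃ W) (h2 : BDPValueAt₃ W) (h3 : IMCDivAt₃ W) :
    BSDp W 3 :=
  hstep (stepLAt_of_halves₃ hnf hctl h1 h2 h3)

end HalvesAtThree

end Summit.BirchSwinnertonDyer.Rank1Residual.X11b.Three

end
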